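import Mathlib
import Summits.MatrixMultiplication.MatrixMultiplication.Theses.HiddenToeplitzCorners

/-!
# Line `twisted-kronecker` — crux `HiddenCorners` (stmt-MatrixMultiplication-7492), strategist gen-4

**WITHDRAWN AT BIRTH (same session; `Lines/twisted_kronecker.dead.md`).**  The subspace `S = ℂ^r ⊗ d` is `T(X)`-invariant for every `X` and
`T` induces `X ⊗ 1_{μ−1}` on `V/S`: the transposed pencil has an honest Kronecker corner of multiplicity `μ − 1` plus an `r`-dimensional garbage
block, `det T(X) = det(X)^{μ−1}·[(1 + cᵀb)·det X − (tr X/r)·cᵀ adj(X) b]` (`b = F₀Ωd`), and HiddenCornerLemmaR prices the family through the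
transpose for every `μ`.  `stub_twist_sp` is TRUE (five lines from the formula) and may be landed as a support; `stub_twist_budget` is
asymptotic ¬HCL-R in costume.  DO NOT SEAT A LEAD.  Original text follows.

SKELETON (2 registered stubs + kernel-checked composition `HiddenCorners_of`).

The mechanism (new on this crux; `Lines/twisted-kronecker.md`, `STRATEGY-CENSUS.md` gen-4 §3.2/§7): the TWISTED KRONECKER CORNER
on `ℂ^r ⊗ ℂ^μ` (an `r × μ` matrix `F`),

    `T(X) F = X F + F₀ Ω Fᵀ X̊ᵀ c dᵀ`,   `X̊ := X − (tr X / r)·1`,  `Ω` antisymmetric `μ × μ`,  `F₀ ∈ ℂ^{r×μ}`, `c ∈ ℂ^r`, `d ∈ ℂ^μ`,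

is unital (`T(1) = 1`), singularity-preserving (`det X = 0 ⇒ det T(X) = 0`, generic corank one on `{det X = 0}` for `μ = 2`), and its
minimal-degree certificate `f = vec F₀` (`χ_X(T(X)) f ≡ 0`) is NOT adjugate-span: `T(X)² f ≠ K vec(X²)` — the first certificate on this
crux outside Lemma (★) of `KroneckerNeutral.md` (so Theorems 1–4 there and the frame hypothesis of `HiddenCornerLemmaR` do not apply as
stated).  Verified numerically exact for `r ∈ {3,4,5,6,7,8}`, `μ ∈ {2,3,4}` (kit j026585, j026603, j026581); found by the (MC)-tangent
computation `e4tangent` (kit j026501, j026547).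

* `stub_twist_sp` (M/L, provable now; the new identity): the pencil of the family is generically nonsingular and singular on every
  singular `X`, for all parameters with `Ωᵀ = −Ω`.
* `stub_twist_budget` (the line's C⁺, open): for every `ε > 0` and frequently in `r`, some member of the family (`μ = μ(r)`, parameters,
  a re-indexing `Fin r × Fin μ ≃ Fin N` and a constant two-sided equivalence `P · Q`) has split Stein width `d ≤ r^ε`, size `N = rμ ≤ r^{2+ε}`
  and generator sparsity `≤ r^{2+ε}`.  Known obstruction (card §Barriers): in ANY basis `d ≥ (r − 1) − 2μ` (Thm 1 of KroneckerNeutral +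
  rank stability, the twist having rank `≤ μ`), so the live regime is `μ ≥ (r−1)/2` and the richer E4 components (rank-≥2 twists, Burnside-
  irreducible, kit j026581) — the lead's first deliverable is the displacement profile `α(r, μ)`.
* `HiddenCorners_of : HiddenCorners` — real proof from the two stubs by name (conjugation bookkeeping + `det_reindex_self`).
-/

set_option linter.unusedVariables false
set_option linter.dupNamespace false

namespace Summit.MatrixMultiplication.MatrixMultiplication.Cruxes.HiddenCorners.TwistedKronecker

open scoped BigOperators Matrix
open Summit.MatrixMultiplication.MatrixMultiplication.Theses.HiddenToeplitzCorners
open Filter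

/-- The lower shift `Z` on `ℂ^N` (route convention, inlined exactly as in the crux). -/
noncomputable def shiftZ (N : ℕ) : Matrix (Fin N) (Fin N) ℂ :=
  Matrix.of fun i j : Fin N => if (i : ℕ) = (j : ℕ) + 1 then (1 : ℂ) else 0

/-- Traceless part `X̊ = X − (tr X / r)·1`. -/
noncomputable def ring {r : ℕ} (X : Matrix (Fin r) (Fin r) ℂ) : Matrix (Fin r) (Fin r) ℂ :=
  X - (X.trace / (r : ℂ)) • (1 : Matrix (Fin r) (Fin r) ℂ)

/-- The twisted Kronecker operator on `r × μ` matrices: `F ↦ X F + F₀ Ω Fᵀ X̊ᵀ c dᵀ`. -/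
noncomputable def twistOp {r μ : ℕ} (F₀ : Matrix (Fin r) (Fin μ) ℂ) (Ω : Matrix (Fin μ) (Fin μ) ℂ)
    (c : Fin r → ℂ) (d : Fin μ → ℂ) (X : Matrix (Fin r) (Fin r) ℂ) (F : Matrix (Fin r) (Fin μ) ℂ) :
    Matrix (Fin r) (Fin μ) ℂ :=
  X * F + F₀ * Ω * Fᵀ * (ring X)ᵀ * Matrix.vecMulVec c d

/-- Its matrix in the basis of matrix units, indexed by `Fin r × Fin μ` (column `q` = image of the unit `E_q`). -/
noncomputable def twistMat {r μ : ℕ} (F₀ : Matrix (Fin r) (Fin μ) ℂ) (Ω : Matrix (Fin μ) (Fin μ) ℂ)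
    (c : Fin r → ℂ) (d : Fin μ → ℂ) (X : Matrix (Fin r) (Fin r) ℂ) :
    Matrix (Fin r × Fin μ) (Fin r × Fin μ) ℂ :=
  Matrix.of fun p q => twistOp F₀ Ω c d X (Matrix.single q.1 q.2 1) p.1 p.2

/-- The coefficient matrices of the family: `T_tw a b := twistMat (E_ab)`. -/
noncomputable def twistCoeff {r μ : ℕ} (F₀ : Matrix (Fin r) (Fin μ) ℂ) (Ω : Matrix (Fin μ) (Fin μ) ℂ)
    (c : Fin r → ℂ) (d : Fin μ → ℂ) (a b : Fin r) : Matrix (Fin r × Fin μ) (Fin r × Fin μ) ℂ :=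
  twistMat F₀ Ω c d (Matrix.single a b 1)

/-- **stub_twist_sp** (M/L; the new identity of the line).  For antisymmetric `Ω` the pencil `Σ X_ab • T_tw a b` of the twisted
Kronecker family is nonsingular at some `X₀` (indeed at `X₀ = 1`, where it is the identity) and singular at every singular `X`.
Paper route: linearity of `twistMat` in `X` gives `Σ X_ab • T_tw a b = twistMat X`; unitality since `X̊ = 0` at `X = 1`; and
`χ_X(twistMat X)(vec F₀) = 0` (the symplectic identities `SᵀΩS = det S·Ω`-type cancellations along the orbit of `F₀`) gives a degree-`r−1`
kernel certificate on `{det X = 0}`; closedness in the parameters removes the genericity assumptions. -/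
theorem stub_twist_sp : ∀ (r μ : ℕ) (F₀ : Matrix (Fin r) (Fin μ) ℂ) (Ω : Matrix (Fin μ) (Fin μ) ℂ)
    (c : Fin r → ℂ) (d : Fin μ → ℂ), 3 ≤ r → 2 ≤ μ → Ωᵀ = -Ω →
    (∃ X₀ : Matrix (Fin r) (Fin r) ℂ, (∑ a : Fin r, ∑ b : Fin r, X₀ a b • twistCoeff F₀ Ω c d a b).det ≠ 0) ∧
    ∀ X : Matrix (Fin r) (Fin r) ℂ, X.det = 0 → (∑ a : Fin r, ∑ b : Fin r, X a b • twistCoeff F₀ Ω c d a b).det = 0 := by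
  sorry

/-- **stub_twist_budget** (the line's C⁺; open).  Frequently in `r`, some member of the twisted Kronecker family, after a re-indexing
`e : Fin r × Fin μ ≃ Fin N` and a constant equivalence `P · Q`, meets the crux's budget: split Stein generators of width `d ≤ r^ε` for the
lower shift on `Fin N`, `N ≤ r^{2+ε}`, generator sparsity `≤ r^{2+ε}`.  Known: `d ≥ r − 1 − 2μ` in every basis, so `μ = μ(r) ≥ (r−1)/2` is
forced; the bet is the large-`μ` regime of this explicit family (and its Burnside-irreducible deformations). -/
theorem stub_twist_budget : ∀ ε : ℝ, 0 < ε → ∃ᶠ r : ℕ in Filter.atTop, ∃ (μ N d : ℕ),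
    3 ≤ r ∧ 2 ≤ μ ∧ (N : ℝ) ≤ (r : ℝ) ^ (2 + ε) ∧ (d : ℝ) ≤ (r : ℝ) ^ ε ∧
    ∃ (F₀ : Matrix (Fin r) (Fin μ) ℂ) (Ω : Matrix (Fin μ) (Fin μ) ℂ) (c : Fin r → ℂ) (d' : Fin μ → ℂ)
      (e : Fin r × Fin μ ≃ Fin N) (P Q : Matrix (Fin N) (Fin N) ℂ),
      Ωᵀ = -Ω ∧ IsUnit P.det ∧ IsUnit Q.det ∧
      ∃ (G₀ H₀ : Matrix (Fin N) (Fin d) ℂ) (G₁ H₁ : Fin r → Fin r → Matrix (Fin N) (Fin d) ℂ),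
        (∀ a b, P * Matrix.reindex e e (twistCoeff F₀ Ω c d' a b) * Q
            - shiftZ N * (P * Matrix.reindex e e (twistCoeff F₀ Ω c d' a b) * Q) * (shiftZ N)ᵀ
            = G₀ * (H₁ a b)ᵀ + G₁ a b * H₀ᵀ) ∧
        ((∑ a : Fin r, ∑ b : Fin r, ((Finset.univ.filter fun p : Fin N × Fin d => G₁ a b p.1 p.2 ≠ 0).card
            + (Finset.univ.filter fun p : Fin N × Fin d => H₁ a b p.1 p.2 ≠ 0).card) : ℕ) : ℝ) ≤ (r : ℝ) ^ (2 + ε) := by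
  sorry

/-- Conjugation bookkeeping: the pencil of the conjugated, re-indexed coefficients is the conjugate of the re-indexed pencil. -/
lemma pencil_conj {r N : ℕ} {ι : Type*} [Fintype ι] [DecidableEq ι]
    (S : Fin r → Fin r → Matrix ι ι ℂ) (e : ι ≃ Fin N) (P Q : Matrix (Fin N) (Fin N) ℂ)
    (X : Matrix (Fin r) (Fin r) ℂ) :
    (∑ a : Fin r, ∑ b : Fin r, X a b • (P * Matrix.reindex e e (S a b) * Q))
      = P * Matrix.reindex e e (∑ a : Fin r, ∑ b : Fin r, X a b • S a b) * Q := by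
  have hre : Matrix.reindex e e (∑ a : Fin r, ∑ b : Fin r, X a b • S a b)
      = ∑ a : Fin r, ∑ b : Fin r, X a b • Matrix.reindex e e (S a b) := by
    ext i j
    simp [Matrix.reindex_apply, Matrix.submatrix_apply, Matrix.sum_apply, Matrix.smul_apply]
  rw [hre, Matrix.mul_sum, Matrix.sum_mul]
  refine Finset.sum_congr rfl fun a _ => ?_
  rw [Matrix.mul_sum, Matrix.sum_mul]
  refine Finset.sum_congr rfl fun b _ => ?_
  rw [Matrix.mul_smul, Matrix.smul_mul]

/-- **Composition.**  The two stubs give the crux `HiddenCorners` BY NAME (sorries only inside `stub_*`). -/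
theorem HiddenCorners_of : HiddenCorners := by
  intro ε hε
  refine (stub_twist_budget ε hε).mono ?_
  rintro r ⟨μ, N, d, hr, hμ, hN, hd, F₀, Ω, c, d', e, P, Q, hΩ, hP, hQ, G₀, H₀, G₁, H₁, hdisp, hsparse⟩
  refine ⟨N, d, hN, hd, fun a b => P * Matrix.reindex e e (twistCoeff F₀ Ω c d' a b) * Q, G₀, H₀, G₁, H₁, ?_, ?_, ?_, ?_⟩
  · intro a b
    exact hdisp a b
  · exact hsparse
  · -- generic nonsingularity transported through the conjugation
    obtain ⟨⟨X₀, hX₀⟩, -⟩ := stub_twist_sp r μ F₀ Ω c d' hr hμ hΩ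
    refine ⟨X₀, ?_⟩
    rw [pencil_conj, Matrix.det_mul, Matrix.det_mul, Matrix.det_reindex_self]
    exact mul_ne_zero (mul_ne_zero hP.ne_zero hX₀) hQ.ne_zero
  · -- singularity on singular X transported through the conjugation
    intro X hX
    obtain ⟨-, hsing⟩ := stub_twist_sp r μ F₀ Ω c d' hr hμ hΩ
    rw [pencil_conj, Matrix.det_mul, Matrix.det_mul, Matrix.det_reindex_self, hsing X hX, mul_zero, zero_mul]

end Summit.MatrixMultiplication.MatrixMultiplication.Cruxes.HiddenCorners.TwistedKronecker
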